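import Summits.NavierStokesRegularity.NavierStokesRegularity.Theses.AxisymmetricExtremality
import Summits.NavierStokesRegularity.NavierStokesRegularity.Theorems.AxisymmetricExtremalityAxisymmetricKatoGlobalNoSwirlStratum
import Literature.Analysis.FluidPDE.AxisymmetricReflection
import HarnessLib

/-!
# Strategist s12 — typed companions of STRATEGY-CENSUS-s12 (crux `AxisymmetricKatoGlobal`,
route `AxisymmetricExtremality`)

Census workfile (not a line, not a proposal). It types the statements the census talks about and
kernel-checks the logical relations claimed there:

* `NoAxisymMinimalBlowupDatum` (W1) — the threshold instance of the crux that `closes` actually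
  consumes; `closes_of_w1` re-proves the route's deciding theorem from it, `w1_of_crux` shows it is
  weaker than the crux.
* `AxisymNoSwirlKatoGlobal` (W2) — the swirl-free (= `O(2)`-equivariant) stratum of the crux, in the
  route's unfolded style; `axisymNoSwirlKatoGlobal_holds` PROVES it from the landed theorem
  `AxisymmetricKatoGlobal.NoSwirlStratum.axisymmetricKatoGlobal_noSwirl_stratum` and
  `IsAxisymmetric.hasNoSwirl_of_reflY_eq`.
* `MinimalDatumDihedral`, `DihedralToO2` — the re-typed sister items under which W2 suffices;
  `closes_reglued : MinimalDatumDihedral → DihedralToO2 → AxisymNoSwirlKatoGlobal → S` and hence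
  `summit_of_dihedral : MinimalDatumDihedral → DihedralToO2 → S` (AX_H eliminated).
* `AxisymWithSwirlKatoGlobal` + `crux_of_split` — the honest 2-piece decomposition
  (swirl-free ∨ with swirl) whose second piece is the whole difficulty.
-/

set_option linter.dupNamespace false
set_option autoImplicit false

open MeasureTheory
open Literature.Analysis.FluidPDE Literature.Analysis.FunctionSpaces

namespace Summit.NavierStokesRegularity.NavierStokesRegularity.Cruxes.AxisymmetricKatoGlobal.StrategistS12

open Summit.NavierStokesRegularity.NavierStokesRegularity.Theses.AxisymmetricExtremality
  (MinimalDatumPFold PFoldToAxisymmetric AxisymmetricKatoGlobal)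

/-- **W1 (threshold instance).** For every `ν > 0` there is no axisymmetric `Ḣ^{1/2}`-minimal
blow-up datum. This is exactly what `closes` consumes of AX_H. -/
def NoAxisymMinimalBlowupDatum : Prop :=
  ∀ ν : ℝ, 0 < ν → ¬ ∃ (u₀ : EuclideanSpace ℝ (Fin 3) → EuclideanSpace ℝ (Fin 3))
    (g : HomSobolev (EuclideanSpace ℝ (Fin 3)) (EuclideanSpace ℂ (Fin 3)) (1 / 2 : ℝ)),
    IsMinimalBlowupDatum ν u₀ g ∧ IsAxisymmetric u₀

/-- **W2 (swirl-free stratum).** The crux restricted to data that are ALSO equivariant under the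
meridian reflection `σ (x₀,x₁,x₂) = (x₀,−x₁,x₂)` (i.e. `O(2)`-equivariant, i.e. swirl-free). -/
def AxisymNoSwirlKatoGlobal : Prop :=
  ∀ ν : ℝ, 0 < ν → ∀ (u₀ : EuclideanSpace ℝ (Fin 3) → EuclideanSpace ℝ (Fin 3))
    (g : HomSobolev (EuclideanSpace ℝ (Fin 3)) (EuclideanSpace ℂ (Fin 3)) (1 / 2 : ℝ)),
    MemLp u₀ 3 volume → g.Represents (Literature.Analysis.FunctionSpaces.EuclideanSpace.complexify ∘ u₀) →
    IsWeaklyDivFree u₀ →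
    (∀ (θ : ℝ) (x : EuclideanSpace ℝ (Fin 3)),
      u₀ (WithLp.toLp 2 ![Real.cos θ * x 0 - Real.sin θ * x 1, Real.sin θ * x 0 + Real.cos θ * x 1, x 2]) =
        WithLp.toLp 2 ![Real.cos θ * u₀ x 0 - Real.sin θ * u₀ x 1,
          Real.sin θ * u₀ x 0 + Real.cos θ * u₀ x 1, u₀ x 2]) →
    (∀ x : EuclideanSpace ℝ (Fin 3),
      u₀ (WithLp.toLp 2 ![x 0, -x 1, x 2]) = WithLp.toLp 2 ![u₀ x 0, -(u₀ x 1), u₀ x 2]) →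
    HasGlobalKatoSolution ν u₀

/-- **Sister item, dihedral version.** As `MinimalDatumPFold`, but the minimal blow-up datum is
`D_p`-equivariant: `R_{2π/p}`-equivariant AND `σ`-equivariant. -/
def MinimalDatumDihedral : Prop :=
  ∀ ν : ℝ, 0 < ν → (∃ v₀ : EuclideanSpace ℝ (Fin 3) → EuclideanSpace ℝ (Fin 3),
      ContDiff ℝ (⊤ : ℕ∞) v₀ ∧ NSWave0.IsDivFree v₀ ∧ HasRapidSpatialDecay v₀ ∧
      ¬ ∃ (u : ℝ → EuclideanSpace ℝ (Fin 3) → EuclideanSpace ℝ (Fin 3))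
          (p : ℝ → EuclideanSpace ℝ (Fin 3) → ℝ),
        IsSmoothOnHalfSpace u ∧ IsSmoothOnHalfSpace p ∧ IsNavierStokesSolution ν 0 v₀ u p ∧
          HasBoundedEnergy u) →
    ∀ N : ℕ, ∃ p : ℕ, N ≤ p ∧ 2 ≤ p ∧
      ∃ (u₀ : EuclideanSpace ℝ (Fin 3) → EuclideanSpace ℝ (Fin 3))
        (g : HomSobolev (EuclideanSpace ℝ (Fin 3)) (EuclideanSpace ℂ (Fin 3)) (1 / 2 : ℝ)),
        IsMinimalBlowupDatum ν u₀ g ∧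
        (∀ x : EuclideanSpace ℝ (Fin 3),
          u₀ (WithLp.toLp 2 ![Real.cos (2 * Real.pi / p) * x 0 - Real.sin (2 * Real.pi / p) * x 1,
              Real.sin (2 * Real.pi / p) * x 0 + Real.cos (2 * Real.pi / p) * x 1, x 2]) =
            WithLp.toLp 2 ![Real.cos (2 * Real.pi / p) * u₀ x 0 - Real.sin (2 * Real.pi / p) * u₀ x 1,
              Real.sin (2 * Real.pi / p) * u₀ x 0 + Real.cos (2 * Real.pi / p) * u₀ x 1, u₀ x 2]) ∧
        (∀ x : EuclideanSpace ℝ (Fin 3),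
          u₀ (WithLp.toLp 2 ![x 0, -x 1, x 2]) = WithLp.toLp 2 ![u₀ x 0, -(u₀ x 1), u₀ x 2])

/-- **Sister item, closure step.** Dihedral minimal data for unboundedly many `p` give an
`O(2)`-equivariant (axisymmetric AND `σ`-equivariant) minimal blow-up datum — the landed
`PFoldToAxisymmetric` argument (compactness mod Sim, axis pinning, dense-angle closure) run with
the extra closed condition `σ`-equivariance carried along. -/
def DihedralToO2 : Prop :=
  ∀ ν : ℝ, 0 < ν →
    (∀ N : ℕ, ∃ p : ℕ, N ≤ p ∧ 2 ≤ p ∧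
      ∃ (u₀ : EuclideanSpace ℝ (Fin 3) → EuclideanSpace ℝ (Fin 3))
        (g : HomSobolev (EuclideanSpace ℝ (Fin 3)) (EuclideanSpace ℂ (Fin 3)) (1 / 2 : ℝ)),
        IsMinimalBlowupDatum ν u₀ g ∧
        (∀ x : EuclideanSpace ℝ (Fin 3),
          u₀ (WithLp.toLp 2 ![Real.cos (2 * Real.pi / p) * x 0 - Real.sin (2 * Real.pi / p) * x 1,
              Real.sin (2 * Real.pi / p) * x 0 + Real.cos (2 * Real.pi / p) * x 1, x 2]) =
            WithLp.toLp 2 ![Real.cos (2 * Real.pi / p) * u₀ x 0 - Real.sin (2 * Real.pi / p) * u₀ x 1,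
              Real.sin (2 * Real.pi / p) * u₀ x 0 + Real.cos (2 * Real.pi / p) * u₀ x 1, u₀ x 2]) ∧
        (∀ x : EuclideanSpace ℝ (Fin 3),
          u₀ (WithLp.toLp 2 ![x 0, -x 1, x 2]) = WithLp.toLp 2 ![u₀ x 0, -(u₀ x 1), u₀ x 2])) →
    ∃ (u₀ : EuclideanSpace ℝ (Fin 3) → EuclideanSpace ℝ (Fin 3))
      (g : HomSobolev (EuclideanSpace ℝ (Fin 3)) (EuclideanSpace ℂ (Fin 3)) (1 / 2 : ℝ)),
      IsMinimalBlowupDatum ν u₀ g ∧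
      (∀ (θ : ℝ) (x : EuclideanSpace ℝ (Fin 3)),
        u₀ (WithLp.toLp 2 ![Real.cos θ * x 0 - Real.sin θ * x 1, Real.sin θ * x 0 + Real.cos θ * x 1, x 2]) =
          WithLp.toLp 2 ![Real.cos θ * u₀ x 0 - Real.sin θ * u₀ x 1,
            Real.sin θ * u₀ x 0 + Real.cos θ * u₀ x 1, u₀ x 2]) ∧
      (∀ x : EuclideanSpace ℝ (Fin 3),
        u₀ (WithLp.toLp 2 ![x 0, -x 1, x 2]) = WithLp.toLp 2 ![u₀ x 0, -(u₀ x 1), u₀ x 2])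

/-- **Decomposition piece 2 (with swirl).** The crux restricted to data that are NOT swirl-free. -/
def AxisymWithSwirlKatoGlobal : Prop :=
  ∀ ν : ℝ, 0 < ν → ∀ (u₀ : EuclideanSpace ℝ (Fin 3) → EuclideanSpace ℝ (Fin 3))
    (g : HomSobolev (EuclideanSpace ℝ (Fin 3)) (EuclideanSpace ℂ (Fin 3)) (1 / 2 : ℝ)),
    MemLp u₀ 3 volume → g.Represents (Literature.Analysis.FunctionSpaces.EuclideanSpace.complexify ∘ u₀) →
    IsWeaklyDivFree u₀ → IsAxisymmetric u₀ → ¬ HasNoSwirl u₀ → HasGlobalKatoSolution ν u₀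

/-! ### Bridges between the unfolded clauses and the tree's API -/

/-- The meridian reflection is literally `x ↦ (x₀, −x₁, x₂)`. -/
theorem reflY_eq (x : EuclideanSpace ℝ (Fin 3)) : reflY x = WithLp.toLp 2 ![x 0, -x 1, x 2] := rfl

/-- The unfolded rotation clause is `IsAxisymmetric`. -/
theorem isAxisymmetric_iff_clause (u₀ : EuclideanSpace ℝ (Fin 3) → EuclideanSpace ℝ (Fin 3)) :
    IsAxisymmetric u₀ ↔ ∀ (θ : ℝ) (x : EuclideanSpace ℝ (Fin 3)),
      u₀ (WithLp.toLp 2 ![Real.cos θ * x 0 - Real.sin θ * x 1, Real.sin θ * x 0 + Real.cos θ * x 1, x 2]) =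
        WithLp.toLp 2 ![Real.cos θ * u₀ x 0 - Real.sin θ * u₀ x 1,
          Real.sin θ * u₀ x 0 + Real.cos θ * u₀ x 1, u₀ x 2] := Iff.rfl

/-- The unfolded `σ`-clause is `σ`-equivariance. -/
theorem reflY_equivariant_iff_clause (u₀ : EuclideanSpace ℝ (Fin 3) → EuclideanSpace ℝ (Fin 3)) :
    (∀ x, u₀ (reflY x) = reflY (u₀ x)) ↔
      ∀ x : EuclideanSpace ℝ (Fin 3),
        u₀ (WithLp.toLp 2 ![x 0, -x 1, x 2]) = WithLp.toLp 2 ![u₀ x 0, -(u₀ x 1), u₀ x 2] := Iff.rfl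

/-! ### W2 is a theorem -/

/-- **W2 holds**: an axisymmetric, `σ`-equivariant `L³` divergence-free field is swirl-free
(`IsAxisymmetric.hasNoSwirl_of_reflY_eq`), and the swirl-free stratum of the crux is the landed
theorem `axisymmetricKatoGlobal_noSwirl_stratum`. -/
theorem axisymNoSwirlKatoGlobal_holds : AxisymNoSwirlKatoGlobal := by
  intro ν hν u₀ g hu₀ _hg hdiv hrot hσ
  have hax : IsAxisymmetric u₀ := (isAxisymmetric_iff_clause u₀).2 hrot
  have hσ' : ∀ x, u₀ (reflY x) = reflY (u₀ x) := (reflY_equivariant_iff_clause u₀).2 hσ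
  have hns : HasNoSwirl u₀ := hax.hasNoSwirl_of_reflY_eq hσ'
  exact Theorems.AxisymmetricKatoGlobal.NoSwirlStratum.axisymmetricKatoGlobal_noSwirl_stratum
    ν hν u₀ hu₀ hdiv hax hns

/-- The crux trivially implies its swirl-free stratum (W2 is weaker). -/
theorem axisymNoSwirlKatoGlobal_of_crux (h : AxisymmetricKatoGlobal) : AxisymNoSwirlKatoGlobal :=
  fun ν hν u₀ g hu₀ hg hdiv hrot _ => h ν hν u₀ g hu₀ hg hdiv hrot

/-! ### Re-glued deciding theorem: AX_H replaced by W2 (a theorem) -/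

/-- **Re-glue.** With the sister items in dihedral form, the swirl-free stratum W2 closes the
summit; the proof is the route's `closes`, verbatim up to the extra `σ`-clause. -/
theorem closes_reglued (h₂ : MinimalDatumDihedral) (h₄ : DihedralToO2) (h₃ : AxisymNoSwirlKatoGlobal) :
    NavierStokesRegularity := by
  show Literature.NS.NavierStokesExistenceSmoothR3
  intro ν hν u₀ hsm hdiv hdec
  by_contra hno
  obtain ⟨u₁, g, hmin, hax, hσ⟩ := h₄ ν hν (h₂ ν hν ⟨u₀, hsm, hdiv, hdec, hno⟩)
  obtain ⟨hL3, hrep, hdiv₁, -, hnot⟩ := hmin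
  exact hnot (h₃ ν hν u₁ g hL3 hrep hdiv₁ hax hσ)

/-- **AX_H eliminated.** The two dihedral sister items alone decide the summit. -/
theorem summit_of_dihedral (h₂ : MinimalDatumDihedral) (h₄ : DihedralToO2) : NavierStokesRegularity :=
  closes_reglued h₂ h₄ axisymNoSwirlKatoGlobal_holds

/-- Status bookkeeping: like `MinimalDatumPFold`, the dihedral item is implied by the summit
(vacuously — its antecedent is a Clay failure), so it is summit-equivalent given `DihedralToO2`. -/
theorem minimalDatumDihedral_of_summit (hS : NavierStokesRegularity) : MinimalDatumDihedral := by
  intro ν hν hfail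
  obtain ⟨v₀, hsm, hdiv, hdec, hno⟩ := hfail
  exact absurd (hS ν hν v₀ hsm hdiv hdec) hno

/-- The dihedral item projects onto the route's `MinimalDatumPFold`. -/
theorem minimalDatumPFold_of_dihedral (h : MinimalDatumDihedral) : MinimalDatumPFold := by
  intro ν hν hfail N
  obtain ⟨p, hNp, h2p, u₀, g, hmin, hrot, -⟩ := h ν hν hfail N
  exact ⟨p, hNp, h2p, u₀, g, hmin, hrot⟩

/-! ### W1: the threshold instance -/

/-- W1 is weaker than the crux. -/
theorem w1_of_crux (h : AxisymmetricKatoGlobal) : NoAxisymMinimalBlowupDatum := by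
  intro ν hν ⟨u₀, g, hmin, hax⟩
  obtain ⟨hL3, hrep, hdiv, -, hnot⟩ := hmin
  exact hnot (h ν hν u₀ g hL3 hrep hdiv ((isAxisymmetric_iff_clause u₀).1 hax))

/-- W1 suffices for the route's `closes` as it stands. -/
theorem closes_of_w1 (h₂ : MinimalDatumPFold) (h₄ : PFoldToAxisymmetric) (h₁ : NoAxisymMinimalBlowupDatum) :
    NavierStokesRegularity := by
  show Literature.NS.NavierStokesExistenceSmoothR3
  intro ν hν u₀ hsm hdiv hdec
  by_contra hno
  obtain ⟨u₁, g, hmin, hax⟩ := h₄ ν hν (h₂ ν hν ⟨u₀, hsm, hdiv, hdec, hno⟩)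
  exact h₁ ν hν ⟨u₁, g, hmin, (isAxisymmetric_iff_clause u₁).2 hax⟩

/-! ### The honest decomposition: swirl-free (proved) ∨ with swirl (= the open problem) -/

/-- `crux ⇐ W2 ∧ (with-swirl piece)`; W2 is proved above, so the with-swirl piece is the crux. -/
theorem crux_of_split (h₁ : AxisymNoSwirlKatoGlobal) (h₂ : AxisymWithSwirlKatoGlobal) :
    AxisymmetricKatoGlobal := by
  intro ν hν u₀ g hu₀ hg hdiv hrot
  have hax : IsAxisymmetric u₀ := (isAxisymmetric_iff_clause u₀).2 hrot
  by_cases hns : HasNoSwirl u₀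
  · exact h₁ ν hν u₀ g hu₀ hg hdiv hrot ((reflY_equivariant_iff_clause u₀).1 (hax.reflY_eq_of_hasNoSwirl hns))
  · exact h₂ ν hν u₀ g hu₀ hg hdiv hax hns

/-- Hence the with-swirl piece alone gives the crux. -/
theorem crux_of_withSwirl (h : AxisymWithSwirlKatoGlobal) : AxisymmetricKatoGlobal :=
  crux_of_split axisymNoSwirlKatoGlobal_holds h

end Summit.NavierStokesRegularity.NavierStokesRegularity.Cruxes.AxisymmetricKatoGlobal.StrategistS12
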